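import Literature.Topology.FourManifolds.RailHeart
import Literature.Topology.FourManifolds.SchubertRegularConverse
import HarnessLib

/-!
# Discharges of named facts of `SchubertNormalForm.lean`

`Literature/Topology/FourManifolds/SchubertNormalFormHolds.lean` — proofs-only sibling of
`SchubertNormalForm.lean` (no definitions, no named facts). Each theorem below closes a named
fact `X : Prop` of that file as `X_holds : X` by composing an ACCEPTED reduction theorem of
the tree with the ACCEPTED unconditional `_holds` discharges of all of its hypotheses; nothing
is re-proved and no statement is changed. Recorded by the librarian sweep g25 (2026-08-16,
pass 5c: facts dischargeable in one line from the tree's own lemmas), so that the facts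
census, `#h21_route_deps` and the cone guardrail see these facts as theorems.

Discharged here:

* `Schubert1949_normalPosition_rebuilt_holds` :=
  `Schubert1949_normalPosition_rebuilt_of_regular` `Schubert1949_normalPosition_regular_holds`
  (`SchubertRegularConverse.lean`).

## References

* [Cromwell2004] — see `lean/references.bib` and the docstring of the fact in `SchubertNormalForm.lean`.
-/

namespace Literature.Topology.FourManifolds.Knot

/-- **Discharge of the named fact `Schubert1949_normalPosition_rebuilt`**
(`SchubertNormalForm.lean`): Schubert's theorem for rebuilt presentations in normal position
(the remaining geometric heart of `IsConnectedSum.isIsotopic`). Let `A` be an oriented knot in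
the open northern and `B` one in the open southern hemisphere of `𝕊³`, and let … — obtained as
`Schubert1949_normalPosition_rebuilt_of_regular` applied to the tree's unconditional discharge
`Schubert1949_normalPosition_regular_holds` of its hypothesis (reduction in
`SchubertRegularConverse.lean`).
[cite: Cromwell2004, §4.6 (PDF p. 69)] -/
theorem Schubert1949_normalPosition_rebuilt_holds :
    Schubert1949_normalPosition_rebuilt :=
  Schubert1949_normalPosition_rebuilt_of_regular Schubert1949_normalPosition_regular_holds

end Literature.Topology.FourManifolds.Knot
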